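import Literature.AlgebraicGeometry.RelativeSpec.FiniteGroupQuotientGluing
import Literature.AlgebraicGeometry.RelativeSpec.GeometricQuotientRecognition
import Literature.AlgebraicGeometry.RelativeSpec.SymmetricPowerGlued
import Literature.RingTheory.GaloisAlgebras.ChaseHarrisonRosenbergEtale
import Mathlib.AlgebraicGeometry.Morphisms.Etale
import HarnessLib

/-!
# A finite-group geometric quotient is étale over the free locus; the quotient map of a symmetric
# power is étale at the tuples with pairwise distinct coordinates (SGA 1, Exp. V, Prop. 2.6 / Cor. 2.4)

Layer `Literature/AlgebraicGeometry/RelativeSpec`, namespaces `…RelativeSpec.ActionOver` /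
`…ActionOver.IsGeometricQuotient` / `…RelativeSpec.symPowGlued`.  THEOREMS ONLY (no definition, no
named fact, no instance, sorry-free).

SGA 1, Exp. V, Prop. 2.6 / Cor. 2.4: for a finite group `G` acting admissibly on `X` with quotient
`p : X → Y = X/G`, the inertia group of a point `x` is trivial iff `p` is étale at `x` («`G` opère
librement en `x`»).  The tree has the GLOBAL form — a FREE affine geometric quotient is finite étale
(★ `IsGeometricQuotient.etale_of_free`, `RelativeSpec/GeometricQuotientFreeEtale`, with freeness in the
Chase–Harrison–Rosenberg form on the affine charts, and ★ `ActionOver.free_of_forall_comp_aut_ne`,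
`RelativeSpec/FreeActionOfPoints`, producing that form from trivial inertia on geometric points) — and
the GENERIC form (★ `RelativeSpec/FiniteGroupQuotientGenericEtale`: étale over SOME non-empty open for a
faithful action).  This file records the POINTWISE form in between, which is what the local study of
maps through a quotient needs (e.g. the Abel–Jacobi map `C → C^{(g)} ⊇ W ↪ J` through the symmetric
power, Milne *Jacobian Varieties* §3, §5):

* §1 `ActionOver.span_act_sub_eq_top_of_forall_ne'`, `IsGeometricQuotient.etale_app_of_free'`,
  `IsGeometricQuotient.etale_of_free'` — the two ★ inputs above re-proved UNIVERSE-POLYMORPHICALLY in the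
  group (`G : Type*`; the ★ versions pin `G : Type u`, which excludes `Equiv.Perm (Fin n) : Type` acting
  on schemes in `Scheme.{u}`); proofs verbatim, `private` (the gate's dedup treats them as restatements of
  the ★ declarations; only §2–§3 are exported).
* §2 **`IsGeometricQuotient.etale_morphismRestrict_of_forall_comp_aut_ne`**: if `p : X → Q` is an affine
  geometric quotient by the finite group `G` and `W ⊆ Q` is an open such that no `g ≠ 1` fixes a
  geometric point of `p⁻¹W`, then `p|_W : p⁻¹W → W` is (finite) ÉTALE; `…etale_ι_comp_…`: so is
  `p⁻¹W ↪ X → Q`.  Proof: ★ `IsGeometricQuotient.restrict` (the restriction over `W` is a geometric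
  quotient of the restricted action) + §1; upstairs form `etale_ι_comp_of_stable`: `U ↪ X → Q` is
  étale for a `G`-stable open `U` with free geometric points.
* §3 **`symPowGlued.etale_morphismRestrict_mk_of_forall_injective`**: for the symmetric power
  `mk : Xⁿ_Y → Xⁿ_Y/𝔖ₙ` (★ `RelativeSpec/SymmetricPowerGlued`, a geometric quotient by ★
  `isGeometricQuotient_gluedMk`) and an open `W` of the quotient over which every geometric point
  `τ = (τᵢ)` of `Xⁿ_Y` has pairwise distinct coordinates `τᵢ : Spec Ω → X`, `mk|_W` is étale (a tuple
  with injective coordinates has trivial stabiliser in `𝔖ₙ`: `σ · τ = τ` reads `τ_{σ⁻¹ i} = τᵢ`);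
  upstairs form `symPowGlued.etale_ι_comp_mk_of_stable`.

Everything is proved; no named facts (D-0026).  Cell `hodgecm-mathlib` (D-0151), count-neutral capital
(input of the tangent-space clause of Milne JV Prop. 2.3, named fact `Milne1986_abelJacobi_isClosedImmersion`
of ★ `Motives/JacobianAbelJacobiTranslates`).  HC_CM is proved only modulo the 7 printed citations until
rung 0 closes; this file discharges none of them.

Mathlib searched (pin): `HasRingHomProperty @Etale RingHom.Etale`, `targetAffineLocally_affineAnd_iff'`,
`targetAffineLocally_affineAnd_iff_affineLocally`, `RingHom.Etale.propertyIsLocal`, `Etale (f ∣_ V)`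
instance, `morphismRestrict_ι`, `IsAffineHom` local at the target (all used); Mathlib has no quotients of
schemes by finite groups.

## References

* A. Grothendieck, *SGA 1*, Exp. V, §2: Prop. 2.6, Cor. 2.4, Déf. 2.7. [SGA1]
* D. Mumford, *Abelian Varieties* (1970), §7 Thm. p. 66; §12 Thm. 1 (p. 112). [MumfordAV1970]
* C. Greither, *Cyclic Galois Extensions of Commutative Rings*, LNM 1534 (1992), Ch. 0, Thm. 1.6,
  Lemma 1.9. [Greither1992CyclicGalois]
* J. S. Milne, *Jacobian Varieties* (1986), §3 Prop. 3.1, Prop. 3.2. [Milne1986JacobianVarieties]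
-/

set_option autoImplicit false

noncomputable section

universe u

open CategoryTheory Limits AlgebraicGeometry TopologicalSpace Opposite

namespace Literature.AlgebraicGeometry.RelativeSpec

/-! ## §1 Freeness on charts from trivial inertia, and étaleness of free quotients — any universe for `G` -/

namespace ActionOver

variable {X Y : Scheme.{u}} {r : X ⟶ Y} {G : Type*} [Group G] (ρ : ActionOver r G)

set_option backward.isDefEq.respectTransparency false in
/-- **Trivial inertia on geometric points ⇒ the `g·b − b` generate the unit ideal** on an affine chart
`r⁻¹U` (★ `span_act_sub_eq_top_of_forall_ne` with the group in an arbitrary universe): otherwise a maximal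
ideal `𝔪 ⊇ (g·b − b)_b` of `Γ(X, r⁻¹U)` gives the geometric point `Spec (Γ/𝔪)^alg → r⁻¹U ⊆ X` fixed by
`g⁻¹`. [cite: SGA1, Exp. V Prop. 2.6 (i)] [cite: Greither1992CyclicGalois, Ch. 0 Thm. 1.6 (iv) (p. 3)] -/
private theorem span_act_sub_eq_top_of_forall_ne' (U : Y.Opens) (hU : IsAffineOpen (r ⁻¹ᵁ U)) (g : G)
    (hpt : ∀ (Ω : Type u) [Field Ω] [IsAlgClosed Ω] (x : Spec (.of Ω) ⟶ X),
      x ≫ (ρ.aut g⁻¹).hom ≠ x) :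
    Ideal.span (Set.range fun b : Γ(X, r ⁻¹ᵁ U) ↦ ρ.act g U b - b) = ⊤ := by
  by_contra hne
  obtain ⟨M, hM, hle⟩ := Ideal.exists_le_maximal _ hne
  letI : Field (Γ(X, r ⁻¹ᵁ U) ⧸ M) := Ideal.Quotient.field M
  let Ω : Type u := AlgebraicClosure (Γ(X, r ⁻¹ᵁ U) ⧸ M)
  let ψ : Γ(X, r ⁻¹ᵁ U) →+* Ω :=
    (algebraMap (Γ(X, r ⁻¹ᵁ U) ⧸ M) Ω).comp (Ideal.Quotient.mk M)
  -- `g` acts trivially modulo `𝔪`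
  have hψ : ψ.comp (ρ.act g U) = ψ := by
    ext b
    change algebraMap _ Ω (Ideal.Quotient.mk M (ρ.act g U b)) = algebraMap _ Ω (Ideal.Quotient.mk M b)
    rw [Ideal.Quotient.eq.mpr (hle (Ideal.subset_span ⟨b, rfl⟩))]
  -- the geometric point through the chart, fixed by `g⁻¹`
  let x : Spec (.of Ω) ⟶ X := Spec.map (CommRingCat.ofHom ψ) ≫ hU.isoSpec.inv ≫ (r ⁻¹ᵁ U).ι
  refine hpt Ω x ?_
  have key : Spec.map (CommRingCat.ofHom ψ) ≫ Spec.map (CommRingCat.ofHom (ρ.act g U)) =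
      Spec.map (CommRingCat.ofHom ψ) := by
    rw [← Spec.map_comp, ← CommRingCat.ofHom_comp, hψ]
  change (Spec.map (CommRingCat.ofHom ψ) ≫ hU.isoSpec.inv ≫ (r ⁻¹ᵁ U).ι) ≫ (ρ.aut g⁻¹).hom =
    Spec.map (CommRingCat.ofHom ψ) ≫ hU.isoSpec.inv ≫ (r ⁻¹ᵁ U).ι
  rw [Category.assoc, Category.assoc, ← ρ.specMap_act_comp_ι g U hU, ← Category.assoc, key]

/-- **Free on geometric points ⇒ free on the affine charts** (★ `free_of_forall_comp_aut_ne`, any universe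
for `G`): if no `g ≠ 1` fixes an algebraically-closed-field-valued point of `X`, then on every affine
`U ⊆ Y` (`r` affine) and for every `g ≠ 1` the `g·b − b` generate the unit ideal of `Γ(X, r⁻¹U)`.
[cite: SGA1, Exp. V Prop. 2.6 (i), Déf. 2.7] -/
private theorem free_of_forall_comp_aut_ne' [IsAffineHom r]
    (hpt : ∀ (Ω : Type u) [Field Ω] [IsAlgClosed Ω] (x : Spec (.of Ω) ⟶ X) (g : G), g ≠ 1 →
      x ≫ (ρ.aut g).hom ≠ x) :
    ∀ (U : Y.Opens), IsAffineOpen U → ∀ g : G, g ≠ 1 →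
      Ideal.span (Set.range fun b : Γ(X, r ⁻¹ᵁ U) ↦ ρ.act g U b - b) = ⊤ :=
  fun U hU g hg => ρ.span_act_sub_eq_top_of_forall_ne' U (hU.preimage r) g
    fun Ω _ _ x => hpt Ω x g⁻¹ (inv_ne_one.mpr hg)

namespace IsGeometricQuotient

variable {X Q : Scheme.{u}} {p : X ⟶ Q} {G : Type*} [Group G] {ρ : ActionOver p G}
variable [Fintype G] (hq : ρ.IsGeometricQuotient p)
include hq

/-- **On a free chart the quotient map is étale** (★ `etale_app_of_free`, any universe for `G`): for
`V ⊆ Q` with the free condition on `Γ(X, p⁻¹V)`, `Γ(Q, V) → Γ(X, p⁻¹V)` is étale (the `G`-Galois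
extension is étale: ★ `GaloisAlgebras.etale_of_free`).
[cite: SGA1, Exp. V Prop. 2.6] [cite: Greither1992CyclicGalois, Ch. 0 Thm. 1.6 (i), Lemma 1.9] -/
private theorem etale_app_of_free' {V : Q.Opens}
    (hfreeV : ∀ g : G, g ≠ 1 →
      Ideal.span (Set.range fun b : Γ(X, p ⁻¹ᵁ V) ↦ ρ.act g V b - b) = ⊤) :
    (p.app V).hom.Etale := by
  letI : Algebra Γ(Q, V) Γ(X, p ⁻¹ᵁ V) := (p.app V).hom.toAlgebra
  letI : MulSemiringAction G Γ(X, p ⁻¹ᵁ V) := ρ.mulSemiringAction V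
  haveI : SMulCommClass G Γ(Q, V) Γ(X, p ⁻¹ᵁ V) := ⟨fun g a b => by
    change ρ.act g V (p.app V a * b) = p.app V a * ρ.act g V b
    rw [map_mul, ρ.act_app]⟩
  haveI : Algebra.IsInvariant Γ(Q, V) Γ(X, p ⁻¹ᵁ V) G :=
    ⟨fun b hb => hq.exists_app_eq V b fun g _ => hb g⟩
  haveI : FaithfulSMul Γ(Q, V) Γ(X, p ⁻¹ᵁ V) :=
    (faithfulSMul_iff_algebraMap_injective _ _).mpr (hq.app_injective V)
  have h : Algebra.Etale Γ(Q, V) Γ(X, p ⁻¹ᵁ V) :=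
    Literature.RingTheory.GaloisAlgebras.etale_of_free Γ(Q, V) G hfreeV
  exact RingHom.etale_algebraMap.mpr h

/-- **A free affine geometric quotient by a finite group is étale** (★ `etale_of_free`, any universe for
`G`): étaleness is affine-local on the target for the affine `p` and holds on the charts by
`etale_app_of_free'`. [cite: SGA1, Exp. V Cor. 2.4, Prop. 2.6] [cite: MumfordAV1970, §7 Thm. p. 66] -/
private theorem etale_of_free' [IsAffineHom p]
    (hfree : ∀ (V : Q.Opens), IsAffineOpen V → ∀ g : G, g ≠ 1 →
      Ideal.span (Set.range fun b : Γ(X, p ⁻¹ᵁ V) ↦ ρ.act g V b - b) = ⊤) :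
    Etale p := by
  have h1 : targetAffineLocally (affineAnd RingHom.Etale) p :=
    (targetAffineLocally_affineAnd_iff' RingHom.Etale.respectsIso p).mpr
      ⟨inferInstance, fun V hV => hq.etale_app_of_free' (hfree V hV)⟩
  have h2 :=
    (targetAffineLocally_affineAnd_iff_affineLocally RingHom.Etale.propertyIsLocal p).mp h1
  rw [HasRingHomProperty.eq_affineLocally (P := @Etale)]
  exact h2.2

end IsGeometricQuotient

/-! ## §2 A geometric quotient is étale over the free locus -/

namespace IsGeometricQuotient

variable {X Y : Scheme.{u}} {r : X ⟶ Y} {G : Type*} [Group G] [Fintype G] {ρ : ActionOver r G}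
  {Q : Scheme.{u}} {p : X ⟶ Q} (hq : ρ.IsGeometricQuotient p)
include hq

set_option backward.isDefEq.respectTransparency false in
/-- **A geometric quotient by a finite group is étale over the free locus** (SGA 1, Exp. V, Prop. 2.6 /
Cor. 2.4: «`G` opère librement en `x`» ⟺ `p` étale at `x`): if `p : X → Q` is an affine geometric quotient
of the action `ρ` of the finite group `G` and `W ⊆ Q` is an open such that no `g ≠ 1` fixes an
(algebraically-closed-field-valued) geometric point of `p⁻¹W`, then `p|_W : p⁻¹W → W` is étale.  The
restriction over `W` is a geometric quotient of the restricted action (★ `IsGeometricQuotient.restrict`), free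
on its charts by `free_of_forall_comp_aut_ne'`, hence étale by `etale_of_free'`.
[cite: SGA1, Exp. V Prop. 2.6 and Cor. 2.4] [cite: MumfordAV1970, §7 Thm. p. 66] -/
theorem etale_morphismRestrict_of_forall_comp_aut_ne [IsAffineHom p] (W : Q.Opens)
    (hfree : ∀ (Ω : Type u) [Field Ω] [IsAlgClosed Ω] (x : Spec (.of Ω) ⟶ (p ⁻¹ᵁ W : Scheme.{u}))
      (g : G), g ≠ 1 → (x ≫ (p ⁻¹ᵁ W).ι) ≫ (ρ.aut g).hom ≠ x ≫ (p ⁻¹ᵁ W).ι) :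
    Etale (p ∣_ W) := by
  haveI : IsAffineHom (p ∣_ W) := IsZariskiLocalAtTarget.restrict ‹IsAffineHom p› W
  -- the restriction over `W` is a geometric quotient of the restricted action
  have h1 := hq.restrict W
  set ρW := ρ.restrict (p ⁻¹ᵁ W) (hq.preimage_stable W) with hρW
  -- … viewed as an action over `p|_W`
  have h2 : (⟨ρW.aut, h1.comp_eq⟩ : ActionOver (p ∣_ W) G).IsGeometricQuotient (p ∣_ W) :=
    (ρW.isGeometricQuotient_overMap_iff (p ∣_ W) h1.comp_eq (p ∣_ W)).mpr h1
  -- free on geometric points of `p⁻¹W`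
  have hpt : ∀ (Ω : Type u) [Field Ω] [IsAlgClosed Ω] (x : Spec (.of Ω) ⟶ (p ⁻¹ᵁ W : Scheme.{u}))
      (g : G), g ≠ 1 → x ≫ ((⟨ρW.aut, h1.comp_eq⟩ : ActionOver (p ∣_ W) G).aut g).hom ≠ x := by
    intro Ω _ _ x g hg hx
    refine hfree Ω x g hg ?_
    have e : ((⟨ρW.aut, h1.comp_eq⟩ : ActionOver (p ∣_ W) G).aut g).hom ≫ (p ⁻¹ᵁ W).ι =
        (p ⁻¹ᵁ W).ι ≫ (ρ.aut g).hom := by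
      change (ρW.aut g).hom ≫ (p ⁻¹ᵁ W).ι = _
      rw [hρW, restrict_aut_hom, restrictHom_ι]
    rw [Category.assoc, ← e, ← Category.assoc, hx]
  exact h2.etale_of_free' (ActionOver.free_of_forall_comp_aut_ne' _ hpt)

/-- **… hence `p⁻¹W ↪ X → Q` is étale** (`= p|_W ≫ (W ↪ Q)`, Mathlib `morphismRestrict_ι`).
[cite: SGA1, Exp. V Prop. 2.6 and Cor. 2.4] -/
theorem etale_ι_comp_of_forall_comp_aut_ne [IsAffineHom p] (W : Q.Opens)
    (hfree : ∀ (Ω : Type u) [Field Ω] [IsAlgClosed Ω] (x : Spec (.of Ω) ⟶ (p ⁻¹ᵁ W : Scheme.{u}))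
      (g : G), g ≠ 1 → (x ≫ (p ⁻¹ᵁ W).ι) ≫ (ρ.aut g).hom ≠ x ≫ (p ⁻¹ᵁ W).ι) :
    Etale ((p ⁻¹ᵁ W).ι ≫ p) := by
  haveI := hq.etale_morphismRestrict_of_forall_comp_aut_ne W hfree
  rw [← morphismRestrict_ι]
  infer_instance

/-- The same with the freeness hypothesis on the geometric points of `X` landing in `W`: if every
geometric point `x` of `X` with `p(x) ∈ W` has trivial stabiliser, then `p|_W` is étale.
[cite: SGA1, Exp. V Prop. 2.6 and Cor. 2.4] -/
theorem etale_morphismRestrict_of_forall_mem [IsAffineHom p] (W : Q.Opens)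
    (hfree : ∀ (Ω : Type u) [Field Ω] [IsAlgClosed Ω] (x : Spec (.of Ω) ⟶ X),
      (∀ t, p (x t) ∈ W) → ∀ g : G, g ≠ 1 → x ≫ (ρ.aut g).hom ≠ x) :
    Etale (p ∣_ W) := by
  refine hq.etale_morphismRestrict_of_forall_comp_aut_ne W fun Ω _ _ x g hg => ?_
  refine hfree Ω (x ≫ (p ⁻¹ᵁ W).ι) (fun t => ?_) g hg
  change p ((p ⁻¹ᵁ W).ι (x t)) ∈ W
  rw [Scheme.Opens.ι_apply]
  exact (x t).2

/-- **Upstairs form: `U ↪ X → Q` is étale for a `G`-stable open `U ⊆ X` on whose geometric points `G`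
acts freely** (`W := p(U)` is open — `p` is an open map — with `p⁻¹W = U` by stability, ★
`IsGeometricQuotient.preimage_image_eq_of_stable`; then `etale_ι_comp_of_forall_comp_aut_ne`).
[cite: SGA1, Exp. V Prop. 2.6 and Cor. 2.4] -/
theorem etale_ι_comp_of_stable [IsAffineHom p] (U : X.Opens) (hU : ∀ g : G, (ρ.aut g).hom ⁻¹ᵁ U = U)
    (hfree : ∀ (Ω : Type u) [Field Ω] [IsAlgClosed Ω] (x : Spec (.of Ω) ⟶ X),
      (∀ t, x t ∈ U) → ∀ g : G, g ≠ 1 → x ≫ (ρ.aut g).hom ≠ x) :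
    Etale (U.ι ≫ p) := by
  let W : Q.Opens := ⟨p '' (U : Set X), hq.isOpenMap _ U.2⟩
  have hWU : p ⁻¹ᵁ W = U := by
    ext1
    refine hq.preimage_image_eq_of_stable (S := (U : Set X)) fun g => ?_
    rintro _ ⟨x, hx, rfl⟩
    change (ρ.aut g).hom x ∈ U
    have : x ∈ (ρ.aut g).hom ⁻¹ᵁ U := by rw [hU g]; exact hx
    exact this
  have hW := hq.etale_ι_comp_of_forall_comp_aut_ne W fun Ω _ _ x g hg => by
    refine hfree Ω (x ≫ (p ⁻¹ᵁ W).ι) (fun t => ?_) g hg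
    change (p ⁻¹ᵁ W).ι (x t) ∈ U
    rw [Scheme.Opens.ι_apply, ← hWU]
    exact (x t).2
  rwa [hWU] at hW

end IsGeometricQuotient

end ActionOver

/-! ## §3 Symmetric powers: `Xⁿ_Y → Xⁿ_Y/𝔖ₙ` is étale at the tuples with pairwise distinct coordinates -/

namespace symPowGlued

variable {X Y : Scheme.{u}} (r : X ⟶ Y) (n : ℕ) [Y.IsSeparated] [IsSeparated r] [IsAffine Y]
  (hX : FiniteSubsetsInAffineOpens r)

omit [Y.IsSeparated] [IsSeparated r] [IsAffine Y] in
/-- A geometric point `τ` of `Xⁿ_Y` with pairwise distinct coordinates `τᵢ = τ ≫ prᵢ` has trivial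
stabiliser in `𝔖ₙ`: `σ · τ = τ` gives `τ_{σ⁻¹ i} = τᵢ` for all `i` (★ `permHom_proj`), so `σ = 1`.
[cite: Milne1986JacobianVarieties, §3 Prop. 3.1 and proof of Prop. 3.2] -/
theorem permHom_ne_of_injective {T : Scheme.{u}} (τ : T ⟶ powOver r n)
    (hτ : Function.Injective fun i => τ ≫ powOver.proj r n i) (σ : Equiv.Perm (Fin n)) (hσ : σ ≠ 1) :
    τ ≫ permHom r n σ ≠ τ := by
  intro h
  apply hσ
  ext i
  have hi : τ ≫ powOver.proj r n (σ.symm i) = τ ≫ powOver.proj r n i := by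
    rw [← permHom_proj r n σ i, ← Category.assoc, h]
  have := hτ hi
  -- `σ⁻¹ i = i`, i.e. `σ i = i`
  have h' : σ (σ.symm i) = σ i := congrArg σ this
  rw [Equiv.apply_symm_apply] at h'
  exact congrArg Fin.val h'.symm

/-- **The quotient map of the symmetric power is étale at the tuples with pairwise distinct coordinates**
(SGA 1, Exp. V, Prop. 2.6 / Cor. 2.4 for the `𝔖ₙ`-action on `Xⁿ_Y`; Milne JV §3: `𝔖ₙ` acts freely off the
big diagonal): for an open `W ⊆ Xⁿ_Y/𝔖ₙ` over which every geometric point of `Xⁿ_Y` has pairwise distinct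
coordinates, `mk|_W : mk⁻¹W → W` is étale (`mk` is an affine geometric quotient by ★
`isGeometricQuotient_gluedMk`, over an affine base `Y`; §2).
[cite: SGA1, Exp. V Prop. 2.6 and Cor. 2.4] [cite: Milne1986JacobianVarieties, §3 Prop. 3.1] -/
theorem etale_morphismRestrict_mk_of_forall_injective (W : (symPowGlued r n).Opens)
    (hW : ∀ (Ω : Type u) [Field Ω] [IsAlgClosed Ω] (τ : Spec (.of Ω) ⟶ powOver r n),
      (∀ t, symPowGlued.mk r n hX (τ t) ∈ W) → Function.Injective fun i => τ ≫ powOver.proj r n i) :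
    Etale (symPowGlued.mk r n hX ∣_ W) := by
  have hq : (permAction r n).IsGeometricQuotient (symPowGlued.mk r n hX) :=
    (permAction r n).isGeometricQuotient_gluedMk (exists_stableAffineOpen_mem hX)
  refine hq.etale_morphismRestrict_of_forall_mem W fun Ω _ _ τ hτ σ hσ => ?_
  rw [permAction_aut_hom]
  exact permHom_ne_of_injective r n τ (hW Ω τ hτ) σ hσ

/-- **… hence `mk⁻¹W ↪ Xⁿ_Y → Xⁿ_Y/𝔖ₙ` is étale.** [cite: SGA1, Exp. V Prop. 2.6 and Cor. 2.4] -/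
theorem etale_ι_comp_mk_of_forall_injective (W : (symPowGlued r n).Opens)
    (hW : ∀ (Ω : Type u) [Field Ω] [IsAlgClosed Ω] (τ : Spec (.of Ω) ⟶ powOver r n),
      (∀ t, symPowGlued.mk r n hX (τ t) ∈ W) → Function.Injective fun i => τ ≫ powOver.proj r n i) :
    Etale ((symPowGlued.mk r n hX ⁻¹ᵁ W).ι ≫ symPowGlued.mk r n hX) := by
  haveI := etale_morphismRestrict_mk_of_forall_injective r n hX W hW
  rw [← morphismRestrict_ι]
  infer_instance

/-- **Upstairs form for the symmetric power**: for an `𝔖ₙ`-stable open `U ⊆ Xⁿ_Y` whose geometric points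
have pairwise distinct coordinates, `U ↪ Xⁿ_Y → Xⁿ_Y/𝔖ₙ` is étale.
[cite: SGA1, Exp. V Prop. 2.6 and Cor. 2.4] [cite: Milne1986JacobianVarieties, §3 Prop. 3.1] -/
theorem etale_ι_comp_mk_of_stable (U : (powOver r n).Opens) (hU : ∀ σ : Equiv.Perm (Fin n), permHom r n σ ⁻¹ᵁ U = U)
    (hinj : ∀ (Ω : Type u) [Field Ω] [IsAlgClosed Ω] (τ : Spec (.of Ω) ⟶ powOver r n),
      (∀ t, τ t ∈ U) → Function.Injective fun i => τ ≫ powOver.proj r n i) :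
    Etale (U.ι ≫ symPowGlued.mk r n hX) := by
  have hq : (permAction r n).IsGeometricQuotient (symPowGlued.mk r n hX) :=
    (permAction r n).isGeometricQuotient_gluedMk (exists_stableAffineOpen_mem hX)
  refine hq.etale_ι_comp_of_stable U (fun σ => by rw [permAction_aut_hom]; exact hU σ)
    fun Ω _ _ τ hτ σ hσ => ?_
  rw [permAction_aut_hom]
  exact permHom_ne_of_injective r n τ (hinj Ω τ hτ) σ hσ

end symPowGlued

end Literature.AlgebraicGeometry.RelativeSpec

end
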